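import Mathlib
import Summits.MatrixMultiplication.MatrixMultiplication.Theses.FourierTwoFamiliesModP
import Summits.MatrixMultiplication.MatrixMultiplication.Theorems.FourierTwoFamiliesModPCyclicReduction
import Summits.MatrixMultiplication.MatrixMultiplication.Theorems.FourierTwoFamiliesModPPrimeTwoFamiliesStubHonestOfSelfConverse
import Summits.MatrixMultiplication.MatrixMultiplication.Theorems.FourierTwoFamiliesModPPrimeTwoFamiliesStubCapBookkeeping
import Summits.MatrixMultiplication.MatrixMultiplication.Theorems.FourierTwoFamiliesModPPrimeTwoFamiliesStubGadgetsOfCrux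

/-!
# Self-converse gadgets `↔ PrimeTwoFamilies` — the honest route (siege k5, API route)

Crux `PrimeTwoFamilies` (stmt-MatrixMultiplication-14308, route `FourierTwoFamiliesModP`: CKSU 2005 Conj. 4.7
with prime cyclic hosts), line `Sketch` in its capacity-gadget form (Cruxes/PrimeTwoFamilies/Lines/Sketch.lean),
registered stub `selfConverseGadgets_iff_primeTwoFamilies`.

A SELF-CONVERSE GADGET at level `ε` is a modulus `m`, letters `(P c, Q c)_{c<r}` in `ℤ/m` with every letter
DIRECT (`(x - x') + (y - y') = 0 → x = x' ∧ y = y'` inside one letter), a map `π : Fin r → Fin r` such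
that every ordered pair of distinct letters `σ ≠ τ` is STRONGLY SEPARATED — every cross difference `q - p`
(`p ∈ P σ`, `q ∈ Q τ`) avoids every diagonal difference `q' - p'` (`p' ∈ P c`, `q' ∈ Q c`) — either
directly or after `π`, with `r ≥ m^{1-ε}` letters of co-volume `|P c| |Q c| ≥ m^{1-ε}`.  The stub says:
self-converse gadgets at every level `ε > 0` and arbitrarily large `m` exist IFF the crux holds.

This file proves the stub by a route DIFFERENT from the line's composition (which lifts the graph words
`(σ, π σ)` to product blocks in `(ℤ/m)²` — `stub_selfConverse`, `codeLift` — and transfers with two cyclic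
factors, `…CapacityLift.selfConverseGadgets_iff_primeTwoFamilies`).  Here NO lift and NO product is taken:

* (⇒) a self-converse gadget already CONTAINS an honest SDPP family in the SAME group `ℤ/m` — the
  `π`-images of the letters through a popular point (`stub_honestOfSelfConverse`: `n ≥ m^{1/2-ε}` pairs of
  co-volume `≥ m^{1-ε}`); keeping the first `n'` of them, with `n'` chosen by the word-length-`1` case of the
  uniform bookkeeping `stub_capBookkeeping` (host size `m ≤ 2·3·m`), is a witness of the ALL-ABELIAN
  two-families statement (verbatim the left side of the route's support `CyclicReduction`, i.e. CKSU
  Conj. 4.7 over finite abelian groups) with host `H := ZMod m` (`twoFamiliesAbelian_of_honestCyclic`,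
  `twoFamiliesAbelian_of_selfConverseGadgets`); the route's PROVED support `cyclicReduction_proof`
  (Umans' cyclic reduction made effective) turns it into the prime-cyclic crux.
* (⇐) letter repetition, `stub_gadgetsOfCrux`.

So the file also records the intermediate fact that self-converse gadgets give CKSU Conj. 4.7 witnesses
inside their own cyclic group, before any transfer.
-/

-- single-conjunct summit: the mandated namespace repeats `MatrixMultiplication` (summit = sub-problem).
set_option linter.dupNamespace false

namespace Summit.MatrixMultiplication.MatrixMultiplication.Theorems.PrimeTwoFamilies.SiegeK5

open Finset
open Summit.MatrixMultiplication.MatrixMultiplication.Theses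
open Summit.MatrixMultiplication.MatrixMultiplication.Theorems
open Summit.MatrixMultiplication.MatrixMultiplication.Theorems.PrimeTwoFamilies.CapacityLift

/-- **Honest cyclic families give the abelian two-families statement, slice by slice.**  If for every
`ε > 0` there are arbitrarily large `m` and an SDPP family ((W) ∧ (X) verbatim) in `ZMod m` with
`n ≥ m^{1/2-ε}` pairs of co-volume `≥ m^{1-ε}`, then for `0 < δ ≤ 1` and every `n₀` there is a finite
abelian host `H` (namely some `ZMod m`) carrying `n ≥ n₀` SDPP pairs with `|H| ≤ n^{2+δ}` and co-volumes
`≥ n^{2-δ}`.  Bookkeeping: `stub_capBookkeeping` at word length `L = 1` with host size `p := m ≤ 2·3·m`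
chooses how many pairs `n ≤ N` to keep; keep the first `n` (`Fin.castLE`). -/
theorem twoFamiliesAbelian_of_honestCyclic
    (hH : ∀ ε : ℝ, 0 < ε → ∀ m₀ : ℕ, ∃ m ≥ m₀, ∃ n : ℕ, ∃ A B : Fin n → Finset (ZMod m),
      (∀ i : Fin n, ∀ a ∈ A i, ∀ a' ∈ A i, ∀ b ∈ B i, ∀ b' ∈ B i,
          (a - a') + (b - b') = 0 → a = a' ∧ b = b') ∧
      (∀ i j k : Fin n, ∀ a ∈ A i, ∀ a' ∈ A j, ∀ b ∈ B j, ∀ b' ∈ B k,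
          (a - a') + (b - b') = 0 → i = k) ∧
      (m : ℝ) ^ (1 / 2 - ε) ≤ (n : ℝ) ∧
      ∀ i : Fin n, (m : ℝ) ^ (1 - ε) ≤ (((A i).card * (B i).card : ℕ) : ℝ))
    {δ : ℝ} (hδ : 0 < δ) (hδ1 : δ ≤ 1) (n₀ : ℕ) :
    ∃ n ≥ n₀, ∃ (H : Type) (_ : AddCommGroup H) (_ : Fintype H) (A B : Fin n → Finset H),
      (∀ i : Fin n, ∀ a ∈ A i, ∀ a' ∈ A i, ∀ b ∈ B i, ∀ b' ∈ B i,
          (a - a') + (b - b') = 0 → a = a' ∧ b = b') ∧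
      (∀ i j k : Fin n, ∀ a ∈ A i, ∀ a' ∈ A j, ∀ b ∈ B j, ∀ b' ∈ B k,
          (a - a') + (b - b') = 0 → i = k) ∧
      (Fintype.card H : ℝ) ≤ (n : ℝ) ^ (2 + δ) ∧
      ∀ i : Fin n, (n : ℝ) ^ (2 - δ) ≤ (((A i).card * (B i).card : ℕ) : ℝ) := by
  obtain ⟨ε, hε, hbook⟩ := stub_capBookkeeping δ hδ hδ1
  obtain ⟨m₀, hm₀⟩ := hbook n₀
  obtain ⟨m, hm, N, A, B, hW, hX, hN, hcov⟩ := hH ε hε (max m₀ 1)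
  have hm₀m : m₀ ≤ m := le_trans (le_max_left _ _) hm
  have hm1 : 1 ≤ m := le_trans (le_max_right _ _) hm
  haveI : NeZero m := ⟨by omega⟩
  -- bookkeeping at word length `L = 1`, host size `p := m ≤ 2·3·m`
  have hN' : ((m : ℝ) ^ ((1 : ℕ) : ℝ)) ^ (1 / 2 - ε) ≤ (N : ℝ) := by
    rw [Nat.cast_one, Real.rpow_one]
    exact hN
  have hmle : m ≤ 2 * (3 ^ 1 * m ^ 1) := by
    rw [pow_one, pow_one]
    omega
  obtain ⟨n, hn₀, hnN, hmn, hnP⟩ := hm₀ m hm₀m 1 le_rfl N hN' m hmle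
  rw [pow_one] at hnP
  refine ⟨n, hn₀, ZMod m, inferInstance, inferInstance, A ∘ Fin.castLE hnN, B ∘ Fin.castLE hnN,
    fun i => hW (Fin.castLE hnN i), ?_, ?_, fun i => ?_⟩
  · intro i j k a ha a' ha' b hb b' hb' h0
    exact Fin.castLE_injective hnN (hX _ _ _ a ha a' ha' b hb b' hb' h0)
  · rw [ZMod.card]
    exact hmn
  · exact hnP.trans (hcov (Fin.castLE hnN i))

/-- **Self-converse gadgets give CKSU Conj. 4.7 witnesses in their own cyclic group.**  From self-converse
gadgets at every level, for every `δ > 0` and `n₀` there are `n ≥ n₀`, a finite abelian group `H` (a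
`ZMod m`) and `n` SDPP pairs in `H` with `|H| ≤ n^{2+δ}` and co-volumes `≥ n^{2-δ}` — verbatim the
all-abelian side of the route's support `CyclicReduction`.  Proof: `stub_honestOfSelfConverse` (popular
point + `π`: an honest family in the same `ℤ/m`, no lift, no transfer), then
`twoFamiliesAbelian_of_honestCyclic` at `min δ 1` and monotonicity of the two exponents in `δ`. -/
theorem twoFamiliesAbelian_of_selfConverseGadgets
    (h : ∀ ε : ℝ, 0 < ε → ∀ m₀ : ℕ, ∃ m ≥ m₀, ∃ r : ℕ, ∃ P Q : Fin r → Finset (ZMod m),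
      ∃ π : Fin r → Fin r,
      (∀ c : Fin r, ∀ x ∈ P c, ∀ x' ∈ P c, ∀ y ∈ Q c, ∀ y' ∈ Q c,
          (x - x') + (y - y') = 0 → x = x' ∧ y = y') ∧
      (∀ σ τ : Fin r, σ ≠ τ →
        (∀ p ∈ P σ, ∀ q ∈ Q τ, ∀ c : Fin r, ∀ p' ∈ P c, ∀ q' ∈ Q c, q - p ≠ q' - p') ∨
        (∀ p ∈ P (π σ), ∀ q ∈ Q (π τ), ∀ c : Fin r, ∀ p' ∈ P c, ∀ q' ∈ Q c, q - p ≠ q' - p')) ∧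
      (m : ℝ) ^ (1 - ε) ≤ (r : ℝ) ∧
      ∀ c : Fin r, (m : ℝ) ^ (1 - ε) ≤ (((P c).card * (Q c).card : ℕ) : ℝ)) :
    ∀ δ : ℝ, 0 < δ → ∀ n₀ : ℕ, ∃ n ≥ n₀, ∃ (H : Type) (_ : AddCommGroup H) (_ : Fintype H)
      (A B : Fin n → Finset H),
      (∀ i : Fin n, ∀ a ∈ A i, ∀ a' ∈ A i, ∀ b ∈ B i, ∀ b' ∈ B i,
          (a - a') + (b - b') = 0 → a = a' ∧ b = b') ∧
      (∀ i j k : Fin n, ∀ a ∈ A i, ∀ a' ∈ A j, ∀ b ∈ B j, ∀ b' ∈ B k,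
          (a - a') + (b - b') = 0 → i = k) ∧
      (Fintype.card H : ℝ) ≤ (n : ℝ) ^ (2 + δ) ∧
      ∀ i : Fin n, (n : ℝ) ^ (2 - δ) ≤ (((A i).card * (B i).card : ℕ) : ℝ) := by
  have hH := stub_honestOfSelfConverse h
  intro δ hδ n₀
  obtain ⟨n, hn, H, hG, hF, A, B, hW, hX, hHn, hAB⟩ :=
    twoFamiliesAbelian_of_honestCyclic hH (lt_min hδ one_pos) (min_le_right δ 1) (max n₀ 1)
  have hn1 : (1 : ℝ) ≤ n := by exact_mod_cast (le_max_right n₀ 1).trans hn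
  have hmin : min δ 1 ≤ δ := min_le_left δ 1
  refine ⟨n, (le_max_left _ _).trans hn, H, hG, hF, A, B, hW, hX, hHn.trans ?_,
    fun i => le_trans ?_ (hAB i)⟩
  · exact Real.rpow_le_rpow_of_exponent_le hn1 (by linarith)
  · exact Real.rpow_le_rpow_of_exponent_le hn1 (by linarith)

/-- **Self-converse gadgets ↔ `PrimeTwoFamilies`** (registered stub `selfConverseGadgets_iff_primeTwoFamilies`
of line `Sketch`, crux stmt-MatrixMultiplication-14308): for every `ε > 0` and arbitrarily large `m` there
are `r ≥ m^{1-ε}` direct pairs `(P c, Q c)` in `ZMod m` of co-volume `≥ m^{1-ε}` and a map `π` under which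
every ordered pair of distinct letters is strongly separated directly or after `π`, IFF CKSU Conj. 4.7 holds
with prime cyclic hosts.  (⇒) the honest route: `twoFamiliesAbelian_of_selfConverseGadgets` (a witness of
the all-abelian conjecture inside the gadget's own `ℤ/m`) and the route's proved cyclic reduction
`cyclicReduction_proof`; (⇐) letter repetition, `stub_gadgetsOfCrux`.  An independent proof through the
capacity form (graph-word code, product lift, two-factor transfer) is
`…Theorems.PrimeTwoFamilies.CapacityLift.selfConverseGadgets_iff_primeTwoFamilies`. -/
theorem selfConverseGadgets_iff_primeTwoFamilies :
    (∀ ε : ℝ, 0 < ε → ∀ m₀ : ℕ, ∃ m ≥ m₀, ∃ r : ℕ, ∃ P Q : Fin r → Finset (ZMod m),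
      ∃ π : Fin r → Fin r,
      (∀ c : Fin r, ∀ x ∈ P c, ∀ x' ∈ P c, ∀ y ∈ Q c, ∀ y' ∈ Q c,
          (x - x') + (y - y') = 0 → x = x' ∧ y = y') ∧
      (∀ σ τ : Fin r, σ ≠ τ →
        (∀ p ∈ P σ, ∀ q ∈ Q τ, ∀ c : Fin r, ∀ p' ∈ P c, ∀ q' ∈ Q c, q - p ≠ q' - p') ∨
        (∀ p ∈ P (π σ), ∀ q ∈ Q (π τ), ∀ c : Fin r, ∀ p' ∈ P c, ∀ q' ∈ Q c, q - p ≠ q' - p')) ∧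
      (m : ℝ) ^ (1 - ε) ≤ (r : ℝ) ∧
      ∀ c : Fin r, (m : ℝ) ^ (1 - ε) ≤ (((P c).card * (Q c).card : ℕ) : ℝ)) ↔
    FourierTwoFamiliesModP.PrimeTwoFamilies := by
  refine ⟨fun h => ?_, fun hT => stub_gadgetsOfCrux hT⟩
  have hred := cyclicReduction_proof
  unfold FourierTwoFamiliesModP.CyclicReduction at hred
  exact hred.1 (twoFamiliesAbelian_of_selfConverseGadgets h)

end Summit.MatrixMultiplication.MatrixMultiplication.Theorems.PrimeTwoFamilies.SiegeK5
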